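import Summits.QuantumFields.BalabanUV.T4Continuum.Spine.NE3.SlicB8FlatTangentRep
import Summits.QuantumFields.BalabanUV.T4Continuum.Spine.NE3.SlicB8FlatCoexact
import Summits.QuantumFields.BalabanUV.T4Continuum.Support.NE3SpectralCutTorus
import Summits.QuantumFields.BalabanUV.T4Continuum.Support.NE3SmoothBlockMeanInterpolant
import Summits.QuantumFields.BalabanUV.T4Continuum.Support.NE3TangentFlatPush
import Summits.QuantumFields.BalabanUV.T4Continuum.Support.NE3CovariantLineSumGauge
import Summits.QuantumFields.BalabanUV.T4Continuum.Spine.NE3.SlicePoincareSlicB8Gauge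
import HarnessLib

/-!
# T⁴ programme, node NE3 — census R32 CLOSED: (P♮) ON B8's SLICE `slicB8` HOLDS AT THE FLAT BACKGROUND FOR EVERY TORUS SIZE `N`,
# k-UNIFORMLY and N-UNIFORMLY — the END's per-pair hypothesis `hP` is satisfiable at the flat datum on every torus

Cell `pub-balaban-gaps` (track G2, seat `ne3`; writer prover-pub-balaban-gaps-ne3-g6-0, 2026-08-23), census `run/shared/lean/pub/pub-balaban-gaps/ne/NE3.md`
§4 R32 ∕ §12.  WHAT.  THE END (`PairLandauB8EndSfClassTowers.ne3EnergyRateWCov_sfClass_towers`, numeric lines discharged in `EndLinesNonVacuous`)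
asks, per pair, `SlicePoincare L (j+1) W (slicB8 L N (j+1) W) CP (periodBox (N·L^{j+1}))` — the weighted Poincaré inequality
`ξ²·dirSq Y ≤ CP·curlSq_W Y` on B8's tangent slice (`QbarIter = 0` ∧ (1.38)-Landau), modelled on [Balaban1985BackgroundPropagators] Thm 3.3 (3.46).
`SlicePoincareSlicB8Flat` (p361318) proved it at the flat background on the UNIT torus `N = 1`.  THIS FILE PROVES IT AT THE FLAT BACKGROUND FOR
EVERY `N ≥ 1`, every `L ≥ 2`, every level `j`, with ONE constant depending on `d` and `card n` only:
**`slicePoincare_slicB8_flatCfg`** : `SlicePoincare L (j+1) flatCfg (slicB8 L N (j+1) flatCfg) (cpFlat d (card n)) (periodBox (N·L^{j+1}))`,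
`cpFlat d m = m·(18 + (4·C₁(d) + 64·C₂(d))·m)` with the interpolation constants `C₁, C₂` of `NE3SmoothBlockMeanInterpolant` (astronomical, honest).
MECHANISM (`M = L^{j+1}`).  For `Y ∈ slicB8(1)`: (i) the covariant Hodge split at the flat background (`NE3SpectralCutTorus.exists_covHodge_skew`):
`Y = η + D_1 ζ`, `η` co-closed, `ζ` skew periodic; (ii) the CO-CLOSED HALF `Σ‖η‖² ≤ 9M²·Σ‖curl Y‖²` (`SlicB8FlatCoexact`, p362018, every `N`);
(iii) the EXACT HALF by `SlicB8LandauReduction.sum_nhsNormSq_gaugeDir_le_of_isLandauB8` (p363714): `Σ‖D_1 ζ‖² ≤ 2Σ‖D_1 ũ‖² + 32M²Σ‖Δ_1 ũ‖²` for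
ANY skew periodic competitor `ũ` with the same `M`-block means as `ζ` — and THE COMPETITOR IS NOW IN THE TREE: the skew part of the smooth
block-mean-exact interpolant `NE3SmoothBlockMeanInterpolant.smoothInterp M q` of the block means `q` of `ζ` (box-averaged `bmeInterp` + squared-tent
bump), whose Dirichlet energy is `≤ C₁·M^{d−2}·Σ‖dPot q‖²` and whose FLAT LAPLACIAN is `≤ C₂·M^{d−4}·Σ‖dPot q‖²` (the `C¹` gain); (iv) the coarse
datum is paid in curl: `dPot q = (Qcoarse L)^[j+1] η` (`iterate_Qcoarse_dPot` + `QbarIter Y = 0`) and the tree's S-bound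
`NE3HodgeCoexactPoincareEnd.sum_nhsNormSq_iterate_Qcoarse_coexact_le_curl` on the spike-corrected tangent representative (`exists_tangentRep_of_QbarIter_flatCfg`,
R25's corner spike of the accumulated frames) gives `Σ‖dPot q‖² ≤ card n·M^{4−d}·Σ‖curl Y‖²`; every power of `M` cancels against `ξ² = M⁻²`.
No smallness, no constant of Bałaban's; `x = 0` throughout.

CONTENT (0 sorry, no `def`): **`slicePoincare_slicB8_flatCfg`** and its transport along the gauge orbit **`slicePoincare_slicB8_pureGauge`** (every
pure-gauge background `gaugeAct u flatCfg`, every `N`, by `SlicePoincareSlicB8Gauge.slicePoincare_slicB8_gaugeAct`) [folklore]; the matrix helpers and the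
spike-corrected tangent representative (`exists_tangentRep_of_QbarIter_flatCfg`) are file 1, `SlicB8FlatTangentRep`.

HONEST FRAMING.  A statement about OUR slice at the TRIVIAL background: it shows the END's hypothesis SHAPE `hP` is satisfiable on every torus
(as `pairLandauGaugeB8Avg_flat` does for `hB8`), nothing about curved backgrounds or Bałaban's minimisers; (P♮) on `slicB8` at `W = cavg L U_B`
stays the printed-TYPE hypothesis ([Balaban1985BackgroundPropagators] Thm 3.3); **NE3 is NOT proved**; spine PROVED 0∕9; finite T⁴ rung (B)+1 —
NOT continuum YM on ℝ⁴, NOT infinite volume, NOT mass gap, NOT Clay.  PLACEMENT: `Summits/QuantumFields/BalabanUV/T4Continuum/Spine/NE3/`.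
-/

set_option autoImplicit false

open scoped BigOperators Matrix Matrix.Norms.L2Operator
open Finset

namespace Summit.QuantumFields.BalabanUV.T4Continuum.NE3.SlicePoincareSlicB8FlatAllN

open Literature.MathematicalPhysics.QuantumFieldTheory.Balaban1983to89
open B7Prop1Explicit B7Prop2Explicit
open T4AveragingDeficitWall (IsUnitaryCfg IsSkewDir SmallField Ad Plane curlAt curlSq dirSq)
open T4AveragingDeficitWallBoundary (IsPeriodicCfg periodBox mem_periodBox card_periodBox)
open AveragingDeficitPeriodicCounting (IsPeriodicDir)
open AveragingDeficitMultiLevelPrep (TangentIter tower LevelSmall)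
open BlockAveragePushDirGauge (gaugeDir isPeriodicDir_gaugeDir)
open BlockAveragePushDirSplit (flat)
open MinimalActionWitness (flatCfg isPeriodicCfg_flatCfg)
open NE3TangentCovariantTower (QbarIter framePotW QbarIter_flat)
open NE3CurvedFrameKill (framePotW_skew_periodic)
open NE3FramePotBoundW (tower_eq_pow_mul)
open NE3TangentNoGoWords (dPot)
open NE3TangentFlatStructure (Qcoarse)
open NE3CoercivityScaling (flatDiv)
open MatrixNorms (nhsNormSq nhsNormSq_nonneg nhsNormSq_conjTranspose nhsNormSq_le_opNorm_sq opNorm_sq_le_card_mul_nhsNormSq)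
open AveragingDeficitHSInner (nhsNormSq_smul)
open NE3CovariantCalculus (nhsNormSq_sub_le nhsNormSq_neg)
open NE3CovariantWeitzenbock (covDiv)
open NE3CovariantBlockMean (bmeanIterW)
open NE3NestedBlockMeanCovariance (bmeanIterW_one)
open NE3FramePotGauge (bmean iterate_bmean_apply iterate_Qcoarse_dPot iterate_Qcoarse_add)
open NE3FrameFreeSliceUnique (gaugeDir_flatCfg_eq_neg_dPot covDiv_flatCfg_eq_flatDiv)
open NE3FlatHessianCurl (isUnitaryCfg_flatCfg smallField_flatCfg_zero)
open NE3TangentFlatPush (flatCfg_eq_flat)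
open NE3BlockPoincareTangent (dirSq_le_card_mul_sum_nhs)
open NE3FlatWeightedCoercive (sum_nhsNormSq_curl_le_curlSq)
open NE3HodgeCoexactPoincareEnd (sum_nhsNormSq_iterate_Qcoarse_coexact_le_curl curlAt_flatCfg_coexact)
open NE3SlicePoincareShape (SlicePoincare)
open NE3SpectralCutTorus (exists_covHodge_skew)
open NE3.PairLandauB8 (covLapSite avgKernelGauges IsLandauB8)
open NE3.LandauProjectionB8 (covDiv_gaugeDir_eq_covLapSite)
open NE3.TangentProjectionSlicB8 (tangentIter_sub_gaugeDir_of_QbarIter_eq_zero)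
open NE3.PairLandauB8Avg (slicB8 mem_slicB8_iff)
open NE3.SlicePoincareSlicB8Flat (levelSmall_zero cornerSmall_zero flatCfg_eq_one)
open NE3.SlicB8FlatCoexact (sum_nhsNormSq_coclosed_le_curl_of_QbarIter_flatCfg)
open NE3.SlicB8LandauReduction (sum_nhsNormSq_gaugeDir_le_of_isLandauB8)
open NE3.SlicB8FlatTangentRep (half_sub_ct_mem nhsNormSq_half_sub_ct_le half_sub_ct_sub half_sub_ct_sum half_sub_ct_of_skew
  nhsNormSq_covLapSite_flatCfg exists_tangentRep_of_QbarIter_flatCfg)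
open NE3CovariantLineSumCore (nhsNormSq_add_le)
open NE3.SlicePoincareSlicB8Gauge (slicePoincare_slicB8_gaugeAct)
open NE3SmoothBlockMeanInterpolant (corner_shift smoothInterp smoothInterp_add_period sum_block_smoothInterp sum_normSq_dPot_smoothInterp_le
  sum_normSq_lap_smoothInterp_le)

noncomputable section

variable {d : ℕ} {n : Type*} [Fintype n] [DecidableEq n]

/-! ## (P♮) on `slicB8` at the flat background, every torus size -/

/-- **(P♮) ON B8's SLICE AT THE FLAT BACKGROUND FOR EVERY TORUS SIZE, k-UNIFORM AND N-UNIFORM**: for `L ≥ 2`, `N ≥ 1` and every level `j`,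
`SlicePoincare L (j+1) flatCfg (slicB8 L N (j+1) flatCfg) CP (periodBox (N·L^{j+1}))` with
`CP = card n·(18 + (4C₁ + 64C₂)·card n)`, `C₁ = (2 + d·2^{d+4}·4096^d)·(2^{d+1} + 2d²·256^d)`, `C₂ = (8d + 288·d²·2^{d+1}·4096^d)·(2^{d+1} + 2d²·256^d)`
(module docstring). [folklore] -/
theorem slicePoincare_slicB8_flatCfg [Nonempty n] {L N : ℕ} [NeZero N] (hL : 2 ≤ L) (hN : 1 ≤ N) (j : ℕ) :
    SlicePoincare L (j + 1) (flatCfg : Site d → Fin d → (Matrix n n ℂ)ˣ) (slicB8 (d := d) (n := n) L N (j + 1) flatCfg)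
      (Fintype.card n * (18 + (4 * ((2 + (d : ℝ) * (2 : ℝ) ^ (d + 4) * (4096 : ℝ) ^ d) * ((2 : ℝ) ^ (d + 1) + 2 * (d : ℝ) ^ 2 * (256 : ℝ) ^ d))
        + 64 * ((8 * (d : ℝ) + 288 * (d : ℝ) ^ 2 * (2 : ℝ) ^ (d + 1) * (4096 : ℝ) ^ d) * ((2 : ℝ) ^ (d + 1) + 2 * (d : ℝ) ^ 2 * (256 : ℝ) ^ d)))
        * Fintype.card n))
      (periodBox (d := d) (N * L ^ (j + 1))) := by
  intro Y hY
  obtain ⟨hYs, hYP, hLan, hQ⟩ := (mem_slicB8_iff (d := d) (n := n)).1 hY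
  -- constants and bookkeeping
  set C₁ : ℝ := (2 + (d : ℝ) * (2 : ℝ) ^ (d + 4) * (4096 : ℝ) ^ d) * ((2 : ℝ) ^ (d + 1) + 2 * (d : ℝ) ^ 2 * (256 : ℝ) ^ d) with hC₁
  set C₂ : ℝ := (8 * (d : ℝ) + 288 * (d : ℝ) ^ 2 * (2 : ℝ) ^ (d + 1) * (4096 : ℝ) ^ d) * ((2 : ℝ) ^ (d + 1) + 2 * (d : ℝ) ^ 2 * (256 : ℝ) ^ d)
    with hC₂
  have hC₁0 : 0 ≤ C₁ := by positivity
  have hC₂0 : 0 ≤ C₂ := by positivity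
  have hL1 : 1 ≤ L := le_trans (by norm_num) hL
  set M : ℕ := L ^ (j + 1) with hM
  have hM2 : 2 ≤ M := by
    calc 2 ≤ 2 ^ (j + 1) := Nat.le_self_pow (Nat.succ_ne_zero j) 2
      _ ≤ L ^ (j + 1) := Nat.pow_le_pow_left hL (j + 1)
  have hM1 : 1 ≤ M := by omega
  have hMR : (0 : ℝ) < (M : ℝ) := by exact_mod_cast (by omega : 0 < M)
  have hMR' : ((L : ℝ) ^ (j + 1)) = (M : ℝ) := by rw [hM]; push_cast; rfl
  have hPM : N * L ^ (j + 1) = M * N := by rw [hM, Nat.mul_comm]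
  haveI : NeZero (N * L ^ (j + 1)) := ⟨Nat.mul_ne_zero (by omega) (by positivity)⟩
  have hP1 : 1 ≤ N * L ^ (j + 1) := Nat.one_le_iff_ne_zero.mpr (NeZero.ne _)
  have hcard : (0 : ℝ) ≤ Fintype.card n := Nat.cast_nonneg _
  have hWu : IsUnitaryCfg (flatCfg : Site d → Fin d → (Matrix n n ℂ)ˣ) := isUnitaryCfg_flatCfg
  have hWP : IsPeriodicCfg (flatCfg : Site d → Fin d → (Matrix n n ℂ)ˣ) ((N * L ^ (j + 1) : ℕ) : ℤ) := isPeriodicCfg_flatCfg _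
  set Curl : ℝ := ∑ x ∈ periodBox (d := d) (N * L ^ (j + 1)), ∑ π : Plane d,
    nhsNormSq (curlAt (flatCfg (d := d) (n := n)) Y x π.1.1 π.1.2) with hCurl
  have hCurl0 : 0 ≤ Curl := Finset.sum_nonneg fun _ _ => Finset.sum_nonneg fun _ _ => nhsNormSq_nonneg _
  -- (i) the covariant Hodge split at the flat background
  obtain ⟨η, ζ, hηP, hζP, -, hζs, hsplit, hηdiv, -⟩ := exists_covHodge_skew (Y := Y) hWu hP1 hWP hYP hYs
  have hηY : ∀ (y : Site d) (κ : Fin d), η y κ = Y y κ + dPot ζ y κ := by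
    intro y κ; rw [hsplit y κ, gaugeDir_flatCfg_eq_neg_dPot]; abel
  have hηY' : ∀ (y : Site d) (κ : Fin d), η y κ = Y y κ - dPot (fun y => -ζ y) y κ := by
    intro y κ; rw [hηY]; simp only [dPot]; abel
  have hζnegP : ∀ (y : Site d) (τ : Fin d), (fun y => -ζ y) (y + ((N * L ^ (j + 1) : ℕ) : ℤ) • e τ) = (fun y => -ζ y) y := by
    intro y τ; simp only [hζP]
  have hdivη : ∀ x : Site d, flatDiv (fun y μ => Y y μ - dPot (fun y => -ζ y) y μ) x = 0 := by
    intro x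
    have hfun : (fun y μ => Y y μ - dPot (fun y => -ζ y) y μ) = η := by funext y μ; rw [hηY']
    rw [hfun, ← covDiv_flatCfg_eq_flatDiv]; exact hηdiv x
  -- (ii) the co-closed half
  have hA : ∑ x ∈ periodBox (d := d) (N * L ^ (j + 1)), ∑ κ : Fin d, nhsNormSq (η x κ) ≤ 9 * ((L : ℝ) ^ (j + 1)) ^ 2 * Curl := by
    have h := sum_nhsNormSq_coclosed_le_curl_of_QbarIter_flatCfg hL hN j hYs hYP hQ hζnegP hdivη
    calc ∑ x ∈ periodBox (d := d) (N * L ^ (j + 1)), ∑ κ : Fin d, nhsNormSq (η x κ)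
        = ∑ x ∈ periodBox (d := d) (N * L ^ (j + 1)), ∑ κ : Fin d, nhsNormSq (Y x κ - dPot (fun y => -ζ y) x κ) :=
          Finset.sum_congr rfl fun x _ => Finset.sum_congr rfl fun κ _ => by rw [hηY']
      _ ≤ _ := h
  -- (iv) the coarse datum: the block means of `ζ`, paid in curl through the S-bound on the tangent representative
  set q : Site d → Matrix n n ℂ := fun z => ((((M : ℕ) : ℝ) ^ d)⁻¹ : ℝ) • ∑ v ∈ periodBox (d := d) M, ζ ((M : ℤ) • z + v) with hq
  have hζP' : ∀ (y : Site d) (τ : Fin d), ζ (y + ((M * N : ℕ) : ℤ) • e τ) = ζ y := by rw [← hPM]; exact hζP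
  have hqP : ∀ (z : Site d) (τ : Fin d), q (z + (N : ℤ) • e τ) = q z := by
    intro z τ
    simp only [hq]
    congr 1
    exact Finset.sum_congr rfl fun v _ => by rw [corner_shift, hζP']
  have hqs : ∀ z, q z ∈ skewAdjoint (Matrix n n ℂ) := fun z =>
    skewAdjoint.smul_mem _ ((skewAdjoint (Matrix n n ℂ)).sum_mem fun v _ => hζs _)
  have hbmean : ∀ z : Site d, (bmean L)^[j + 1] ζ z = q z := fun z => by rw [iterate_bmean_apply hL1 (j + 1) ζ z]
  -- `dPot q = (Qcoarse L)^[j+1] η`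
  have hQflat : (Qcoarse L)^[j + 1] Y = fun _ _ => 0 := by
    rw [← QbarIter_flat hL1 (j + 1) Y, ← flatCfg_eq_flat]; exact hQ
  have hQη : (Qcoarse L)^[j + 1] η = dPot q := by
    have hηfun : η = fun y μ => Y y μ + dPot ζ y μ := by funext y μ; exact hηY y μ
    have hqfun : (bmean L)^[j + 1] ζ = q := funext hbmean
    rw [hηfun, iterate_Qcoarse_add, hQflat, iterate_Qcoarse_dPot, hqfun]
    funext z κ; simp
  obtain ⟨ζs, hζss, hζsP, hT⟩ := exists_tangentRep_of_QbarIter_flatCfg hL j hYs hYP hQ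
  have hD : ∑ z ∈ periodBox (d := d) N, ∑ κ : Fin d, nhsNormSq (dPot q z κ)
      ≤ (((M : ℝ)) ^ d)⁻¹ * (M : ℝ) ^ 4 * Curl := by
    -- the tangent representative `Y' = Y + dPot ζs` has the co-closed component `η = Y' − dPot (ζs − ζ… )`
    have hY'P : IsPeriodicDir (fun y κ => Y y κ + dPot ζs y κ) ((N * L ^ (j + 1) : ℕ) : ℤ) := by
      intro y τ μ
      show Y (y + ((N * L ^ (j + 1) : ℕ) : ℤ) • e τ) μ + dPot ζs (y + ((N * L ^ (j + 1) : ℕ) : ℤ) • e τ) μ = Y y μ + dPot ζs y μ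
      rw [hYP y τ μ, NE3LineAverage.dPot_add_period hζsP]
    have hpotP : ∀ (x : Site d) (τ : Fin d), (fun y => ζs y - ζ y) (x + ((N * L ^ (j + 1) : ℕ) : ℤ) • e τ) = (fun y => ζs y - ζ y) x := by
      intro x τ; simp only [hζsP, hζP]
    have hfun : (fun y μ => Y y μ + dPot ζs y μ - dPot (fun y => ζs y - ζ y) y μ) = η := by
      funext y μ; rw [hηY]; simp only [dPot]; abel
    have hdiv' : ∀ x : Site d, flatDiv (fun y μ => Y y μ + dPot ζs y μ - dPot (fun y => ζs y - ζ y) y μ) x = 0 := by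
      intro x; rw [hfun, ← covDiv_flatCfg_eq_flatDiv]; exact hηdiv x
    have h := sum_nhsNormSq_iterate_Qcoarse_coexact_le_curl hL1 hN (Y := fun y κ => Y y κ + dPot ζs y κ) hY'P hT hpotP hdiv'
    rw [hfun, hQη] at h
    have hcurl : ∀ (x : Site d) (π : Plane d), curlAt (flatCfg (d := d) (n := n)) (fun y κ => Y y κ + dPot ζs y κ) x π.1.1 π.1.2
        = curlAt (flatCfg (d := d) (n := n)) Y x π.1.1 π.1.2 := by
      intro x π
      have h1 := curlAt_flatCfg_coexact Y (fun y => -ζs y) x π.1.1 π.1.2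
      have hfun' : (fun y κ => Y y κ - dPot (fun y => -ζs y) y κ) = fun y κ => Y y κ + dPot ζs y κ := by
        funext y κ; simp only [dPot]; abel
      rw [hfun'] at h1
      exact h1
    simp_rw [hcurl] at h
    have hMcast : (((L ^ (j + 1) : ℕ) : ℝ)) = (M : ℝ) := by rw [hM]
    rw [hMcast] at h
    exact h
  -- (iii) the competitor: the skew part of the smooth block-mean-exact interpolant of `q`
  set u₀ : Site d → Matrix n n ℂ := smoothInterp M q with hu₀
  set u : Site d → Matrix n n ℂ := fun y => (1 / 2 : ℝ) • (u₀ y - (u₀ y)ᴴ) with hu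
  have hu₀P : ∀ (y : Site d) (τ : Fin d), u₀ (y + ((M * N : ℕ) : ℤ) • e τ) = u₀ y :=
    fun y τ => smoothInterp_add_period hM1 hqP y τ
  have huP : ∀ (y : Site d) (τ : Fin d), u (y + ((N * L ^ (j + 1) : ℕ) : ℤ) • e τ) = u y := by
    intro y τ; simp only [hu, hPM, hu₀P y τ]
  have hus : ∀ y, u y ∈ skewAdjoint (Matrix n n ℂ) := fun y => half_sub_ct_mem _
  -- same block sums as `ζ`
  have hblockζ : ∀ z : Site d, ∑ v ∈ periodBox (d := d) M, u ((M : ℤ) • z + v) = ∑ v ∈ periodBox (d := d) M, ζ ((M : ℤ) • z + v) := by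
    intro z
    have hS : (∑ v ∈ periodBox (d := d) M, ζ ((M : ℤ) • z + v)) ∈ skewAdjoint (Matrix n n ℂ) :=
      (skewAdjoint (Matrix n n ℂ)).sum_mem fun v _ => hζs _
    have h0 : ∑ v ∈ periodBox (d := d) M, u₀ ((M : ℤ) • z + v) = ∑ v ∈ periodBox (d := d) M, ζ ((M : ℤ) • z + v) := by
      rw [hu₀, sum_block_smoothInterp hM2 q z, hq, smul_smul, mul_inv_cancel₀ (by positivity), one_smul]
    calc ∑ v ∈ periodBox (d := d) M, u ((M : ℤ) • z + v)
        = (1 / 2 : ℝ) • ((∑ v ∈ periodBox (d := d) M, u₀ ((M : ℤ) • z + v)) - (∑ v ∈ periodBox (d := d) M, u₀ ((M : ℤ) • z + v))ᴴ) := by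
          rw [half_sub_ct_sum]
      _ = _ := by rw [h0, half_sub_ct_of_skew hS]
  have hmem : (fun y => u y - ζ y) ∈ avgKernelGauges (d := d) (n := n) L N (j + 1) (flatCfg : Site d → Fin d → (Matrix n n ℂ)ˣ) := by
    refine ⟨fun y => (skewAdjoint (Matrix n n ℂ)).sub_mem (hus y) (hζs y), fun y i => by simp only [huP, hζP], ?_⟩
    funext z
    rw [flatCfg_eq_one, bmeanIterW_one, iterate_bmean_apply hL1 (j + 1) _ z, Finset.sum_sub_distrib]
    have hMM : ((L ^ (j + 1) : ℕ) : ℤ) = (M : ℤ) := by rw [hM]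
    rw [hMM, show (L ^ (j + 1)) = M from rfl, hblockζ z, sub_self, smul_zero]
    rfl
  -- the exact half against the competitor
  have hB := sum_nhsNormSq_gaugeDir_le_of_isLandauB8 hL hN j hWu hWP le_rfl (levelSmall_zero hL j) smallField_flatCfg_zero
    (cornerSmall_zero (n := n) L j) hYP hsplit (fun y _ => hηdiv y) hLan hmem
  -- the competitor's two energies, in the op-norm currency of the interpolant files
  have hI1 := sum_normSq_dPot_smoothInterp_le (𝔸 := Matrix n n ℂ) hM2 hN hqP
  have hI2 := sum_normSq_lap_smoothInterp_le (𝔸 := Matrix n n ℂ) hM2 hN hqP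
  set D : ℝ := ∑ z ∈ periodBox (d := d) N, ∑ α : Fin d, ‖dPot q z α‖ ^ 2 with hDdef
  have hDle : D ≤ Fintype.card n * ((((M : ℝ)) ^ d)⁻¹ * (M : ℝ) ^ 4 * Curl) := by
    calc D ≤ ∑ z ∈ periodBox (d := d) N, ∑ α : Fin d, (Fintype.card n * nhsNormSq (dPot q z α)) :=
          Finset.sum_le_sum fun z _ => Finset.sum_le_sum fun α _ => opNorm_sq_le_card_mul_nhsNormSq _
      _ = Fintype.card n * ∑ z ∈ periodBox (d := d) N, ∑ κ : Fin d, nhsNormSq (dPot q z κ) := by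
          rw [Finset.mul_sum]; exact Finset.sum_congr rfl fun z _ => by rw [Finset.mul_sum]
      _ ≤ _ := mul_le_mul_of_nonneg_left hD hcard
  have hE1 : ∑ y ∈ periodBox (d := d) (N * L ^ (j + 1)), ∑ κ : Fin d, nhsNormSq (gaugeDir (flatCfg : Site d → Fin d → (Matrix n n ℂ)ˣ) u y κ)
      ≤ C₁ * ((M : ℝ) ^ d / (M : ℝ) ^ 2) * D := by
    calc ∑ y ∈ periodBox (d := d) (N * L ^ (j + 1)), ∑ κ : Fin d, nhsNormSq (gaugeDir (flatCfg : Site d → Fin d → (Matrix n n ℂ)ˣ) u y κ)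
        ≤ ∑ y ∈ periodBox (d := d) (M * N), ∑ κ : Fin d, ‖dPot u₀ y κ‖ ^ 2 := by
          rw [hPM]
          refine Finset.sum_le_sum fun y _ => Finset.sum_le_sum fun κ _ => ?_
          rw [gaugeDir_flatCfg_eq_neg_dPot, nhsNormSq_neg]
          have hdu : dPot u y κ = (1 / 2 : ℝ) • (dPot u₀ y κ - (dPot u₀ y κ)ᴴ) := by
            simp only [hu, dPot]; rw [half_sub_ct_sub]
          rw [hdu]
          exact (nhsNormSq_half_sub_ct_le _).trans (nhsNormSq_le_opNorm_sq _)
      _ ≤ _ := hI1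
  have hE2 : ∑ y ∈ periodBox (d := d) (N * L ^ (j + 1)), nhsNormSq (covLapSite (flatCfg : Site d → Fin d → (Matrix n n ℂ)ˣ) u y)
      ≤ C₂ * ((M : ℝ) ^ d / (M : ℝ) ^ 4) * D := by
    calc ∑ y ∈ periodBox (d := d) (N * L ^ (j + 1)), nhsNormSq (covLapSite (flatCfg : Site d → Fin d → (Matrix n n ℂ)ˣ) u y)
        ≤ ∑ y ∈ periodBox (d := d) (M * N), ‖∑ μ : Fin d, (dPot u₀ y μ - dPot u₀ (y - e μ) μ)‖ ^ 2 := by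
          rw [hPM]
          refine Finset.sum_le_sum fun y _ => ?_
          rw [nhsNormSq_covLapSite_flatCfg]
          have hdu : ∑ μ : Fin d, (dPot u y μ - dPot u (y - e μ) μ)
              = (1 / 2 : ℝ) • ((∑ μ : Fin d, (dPot u₀ y μ - dPot u₀ (y - e μ) μ)) - (∑ μ : Fin d, (dPot u₀ y μ - dPot u₀ (y - e μ) μ))ᴴ) := by
            rw [half_sub_ct_sum]
            refine Finset.sum_congr rfl fun μ _ => ?_
            simp only [hu, dPot]
            rw [← half_sub_ct_sub, ← half_sub_ct_sub, ← half_sub_ct_sub]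
          rw [hdu]
          exact (nhsNormSq_half_sub_ct_le _).trans (nhsNormSq_le_opNorm_sq _)
      _ ≤ _ := hI2
  -- assembling the exact half: `Σ‖D ζ‖² ≤ (2C₁ + 32C₂)·card n·M²·Curl`
  have hB' : ∑ y ∈ periodBox (d := d) (N * L ^ (j + 1)), ∑ κ : Fin d, nhsNormSq (gaugeDir (flatCfg : Site d → Fin d → (Matrix n n ℂ)ˣ) ζ y κ)
      ≤ (2 * C₁ + 32 * C₂) * Fintype.card n * (M : ℝ) ^ 2 * Curl := by
    have hMd : (0 : ℝ) < (M : ℝ) ^ d := by positivity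
    calc ∑ y ∈ periodBox (d := d) (N * L ^ (j + 1)), ∑ κ : Fin d, nhsNormSq (gaugeDir (flatCfg : Site d → Fin d → (Matrix n n ℂ)ˣ) ζ y κ)
        ≤ 2 * (C₁ * ((M : ℝ) ^ d / (M : ℝ) ^ 2) * D) + 32 * ((L : ℝ) ^ (j + 1)) ^ 2 * (C₂ * ((M : ℝ) ^ d / (M : ℝ) ^ 4) * D) := by
          refine hB.trans (add_le_add (mul_le_mul_of_nonneg_left hE1 (by norm_num)) (mul_le_mul_of_nonneg_left hE2 (by positivity)))
      _ = (2 * C₁ + 32 * C₂) * ((M : ℝ) ^ d / (M : ℝ) ^ 2) * D := by rw [hMR']; field_simp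
      _ ≤ (2 * C₁ + 32 * C₂) * ((M : ℝ) ^ d / (M : ℝ) ^ 2) * (Fintype.card n * ((((M : ℝ)) ^ d)⁻¹ * (M : ℝ) ^ 4 * Curl)) :=
          mul_le_mul_of_nonneg_left hDle (by positivity)
      _ = (2 * C₁ + 32 * C₂) * Fintype.card n * (M : ℝ) ^ 2 * Curl := by field_simp
  -- `Σ‖Y‖² ≤ 2Σ‖η‖² + 2Σ‖D ζ‖²`
  have hYsum : ∑ x ∈ periodBox (d := d) (N * L ^ (j + 1)), ∑ κ : Fin d, nhsNormSq (Y x κ)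
      ≤ (18 + (4 * C₁ + 64 * C₂) * Fintype.card n) * (M : ℝ) ^ 2 * Curl := by
    calc ∑ x ∈ periodBox (d := d) (N * L ^ (j + 1)), ∑ κ : Fin d, nhsNormSq (Y x κ)
        ≤ ∑ x ∈ periodBox (d := d) (N * L ^ (j + 1)), ∑ κ : Fin d,
            (2 * (nhsNormSq (η x κ) + nhsNormSq (gaugeDir (flatCfg : Site d → Fin d → (Matrix n n ℂ)ˣ) ζ x κ))) :=
          Finset.sum_le_sum fun x _ => Finset.sum_le_sum fun κ _ => by rw [hsplit x κ]; exact nhsNormSq_add_le _ _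
      _ = 2 * ∑ x ∈ periodBox (d := d) (N * L ^ (j + 1)), ∑ κ : Fin d, nhsNormSq (η x κ)
          + 2 * ∑ x ∈ periodBox (d := d) (N * L ^ (j + 1)), ∑ κ : Fin d,
              nhsNormSq (gaugeDir (flatCfg : Site d → Fin d → (Matrix n n ℂ)ˣ) ζ x κ) := by
          simp only [Finset.mul_sum, Finset.sum_add_distrib, mul_add]
      _ ≤ 2 * (9 * ((L : ℝ) ^ (j + 1)) ^ 2 * Curl) + 2 * ((2 * C₁ + 32 * C₂) * Fintype.card n * (M : ℝ) ^ 2 * Curl) :=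
          add_le_add (mul_le_mul_of_nonneg_left hA (by norm_num)) (mul_le_mul_of_nonneg_left hB' (by norm_num))
      _ = (18 + (4 * C₁ + 64 * C₂) * Fintype.card n) * (M : ℝ) ^ 2 * Curl := by rw [hMR']; ring
  -- currencies: `dirSq ≤ card n·Σ nhsNormSq`, `Σ_π nhsNormSq (curlAt) ≤ curlSq`, and `ξ²·M² = 1`
  have hξ : (((L : ℝ) ^ (j + 1))⁻¹) ^ 2 * (M : ℝ) ^ 2 = 1 := by
    rw [hMR', ← mul_pow, inv_mul_cancel₀ hMR.ne', one_pow]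
  have hK0 : 0 ≤ 18 + (4 * C₁ + 64 * C₂) * Fintype.card n := by positivity
  calc (((L : ℝ) ^ (j + 1))⁻¹) ^ 2 * dirSq Y (periodBox (d := d) (N * L ^ (j + 1)))
      ≤ (((L : ℝ) ^ (j + 1))⁻¹) ^ 2 * (Fintype.card n * ∑ x ∈ periodBox (d := d) (N * L ^ (j + 1)), ∑ κ : Fin d, nhsNormSq (Y x κ)) :=
        mul_le_mul_of_nonneg_left (dirSq_le_card_mul_sum_nhs _ _) (by positivity)
    _ ≤ (((L : ℝ) ^ (j + 1))⁻¹) ^ 2 * (Fintype.card n * ((18 + (4 * C₁ + 64 * C₂) * Fintype.card n) * (M : ℝ) ^ 2 * Curl)) :=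
        mul_le_mul_of_nonneg_left (mul_le_mul_of_nonneg_left hYsum hcard) (by positivity)
    _ = Fintype.card n * (18 + (4 * C₁ + 64 * C₂) * Fintype.card n) * ((((L : ℝ) ^ (j + 1))⁻¹) ^ 2 * (M : ℝ) ^ 2) * Curl := by ring
    _ = Fintype.card n * (18 + (4 * C₁ + 64 * C₂) * Fintype.card n) * Curl := by rw [hξ, mul_one]
    _ ≤ Fintype.card n * (18 + (4 * C₁ + 64 * C₂) * Fintype.card n)
          * curlSq (flatCfg (d := d) (n := n)) Y (periodBox (d := d) (N * L ^ (j + 1))) :=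
        mul_le_mul_of_nonneg_left (sum_nhsNormSq_curl_le_curlSq Y _) (mul_nonneg hcard hK0)

/-- **(P♮) ON B8's SLICE AT EVERY PURE-GAUGE BACKGROUND, EVERY TORUS SIZE** (the flat witness moved along the gauge orbit by
`SlicePoincareSlicB8Gauge.slicePoincare_slicB8_gaugeAct`): for `L ≥ 2`, `N ≥ 1`, every level `j` and every unitary `(N·L^{j+1})`-periodic gauge
function `u`, `SlicePoincare L (j+1) (gaugeAct u flatCfg) (slicB8 L N (j+1) (gaugeAct u flatCfg)) CP (periodBox (N·L^{j+1}))` with the constant of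
`slicePoincare_slicB8_flatCfg`. [folklore] -/
theorem slicePoincare_slicB8_pureGauge [Nonempty n] {L N : ℕ} [NeZero N] (hL : 2 ≤ L) (hN : 1 ≤ N) (j : ℕ) {u : Site d → (Matrix n n ℂ)ˣ}
    (hu : ∀ y, u y ∈ unitaryUnits (Matrix n n ℂ)) (huP : ∀ (y : Site d) (τ : Fin d), u (y + ((N * L ^ (j + 1) : ℕ) : ℤ) • e τ) = u y) :
    SlicePoincare L (j + 1) (gaugeAct u (flatCfg : Site d → Fin d → (Matrix n n ℂ)ˣ))
      (slicB8 (d := d) (n := n) L N (j + 1) (gaugeAct u (flatCfg : Site d → Fin d → (Matrix n n ℂ)ˣ)))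
      (Fintype.card n * (18 + (4 * ((2 + (d : ℝ) * (2 : ℝ) ^ (d + 4) * (4096 : ℝ) ^ d) * ((2 : ℝ) ^ (d + 1) + 2 * (d : ℝ) ^ 2 * (256 : ℝ) ^ d))
        + 64 * ((8 * (d : ℝ) + 288 * (d : ℝ) ^ 2 * (2 : ℝ) ^ (d + 1) * (4096 : ℝ) ^ d) * ((2 : ℝ) ^ (d + 1) + 2 * (d : ℝ) ^ 2 * (256 : ℝ) ^ d)))
        * Fintype.card n))
      (periodBox (d := d) (N * L ^ (j + 1))) :=
  slicePoincare_slicB8_gaugeAct hL j isUnitaryCfg_flatCfg le_rfl (levelSmall_zero hL j) smallField_flatCfg_zero hu huP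
    (slicePoincare_slicB8_flatCfg hL hN j)

end

end Summit.QuantumFields.BalabanUV.T4Continuum.NE3.SlicePoincareSlicB8FlatAllN
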